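import Mathlib.GroupTheory.SemidirectProduct
import Mathlib.GroupTheory.Index
import Mathlib.Data.ZMod.Basic
import Mathlib.Algebra.Module.ZMod
import Mathlib.Algebra.Ring.Int.Units
import Mathlib.Data.Int.Order.Units
import Mathlib.Algebra.GroupWithZero.Units.Fintype
import Mathlib.Algebra.GroupWithZero.Action.Basic
import Mathlib.Algebra.Group.TransferInstance
import Mathlib.Tactic.Abel
import Mathlib.Tactic.Ring
import Mathlib.Tactic.NormNum
import HarnessLib

/-!
# [IUTchI] §6, Definition 6.1 (i): the label group `𝔽_l^{⋊±}`, `𝔽_l^±`-groups and `𝔽_l^±`-torsors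

Mochizuki, *Inter-universal Teichmüller theory I: construction of Hodge theaters*, §6
"Additive Combinatorial Teichmüller Theory", Definition 6.1 (i), kurims manuscript (May 2020)
p. 155 [cite: Mochizuki2012, IUTchI Def 6.1 (i) p.155]. This is the label combinatorics on which
the `𝔽_l^{⋊±}`-symmetry of `Θ^{±ell}`-Hodge theaters (§6) rests; it has no prerequisites beyond
the finite ring `𝔽_l = ZMod l` and is formalised here over Mathlib, with every claim printed in
Def 6.1 (i) PROVED:

* `𝔽_l^{⋊±} := 𝔽_l ⋊ {±1}` "the group determined by forming the semi-direct product with respect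
  to the natural inclusion `{±1} ↪ 𝔽_l^×`" — `FlPM l`, Mathlib's `SemidirectProduct` of
  `Multiplicative (ZMod l)` by `ℤˣ = {±1}` acting through `ℤˣ → 𝔽_l^×` by multiplication; its
  elements mapping to `+1` (resp. `−1`) are *positive* (resp. *negative*); it acts on `𝔽_l` by
  `z ↦ ±z + λ` (`FlPM.smul_def`).
* an `𝔽_l^±`-group is "any set `E` equipped with a `{±1}`-orbit of bijections `E ≃ 𝔽_l`"
  (`FlPMGroup l E`); "thus, any `𝔽_l^±`-group `E` is equipped with a natural `𝔽_l`-module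
  structure" (`FlPMGroup.addCommGroup`, `FlPMGroup.module`; `FlPMGroup.map_add`: every chart of
  the orbit is additive, so the structure does not depend on the chart).
* `𝔽_l^±`-torsors, `Aut_+(T) ⊆ Aut_±(T)` (the second half of Def 6.1 (i)) are in the companion
  file `LabelsPlusMinusTorsors.lean`.

Design notes. `{±1}` is realised as `ℤˣ` (`Int.units_eq_one_or`); for `l ∈ {1, 2}` the map
`ℤˣ → 𝔽_l^×` is not injective and `z ↦ −z` is the identity, so faithfulness of the action
(`FlPM.toPerm_injective`) carries the hypothesis `2 < l` (in IUT `l ≥ 5` is prime, [IUTchI]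
Def 3.1 (c)). Nothing in Def 6.1 (i) is strengthened; items (ii)–(vii) of Def 6.1 (cusps,
`±`-label classes, `𝒟^{⊚±}`) are typed in companion files.
-/

namespace Literature.IUT.HodgeTheaters

variable (l : ℕ)

/-! ### Signs acting on `𝔽_l` -/

/-- In `𝔽_l`, `(−1) • z = −z` for the sign `−1 ∈ {±1} = ℤˣ`. [folklore] -/
private theorem neg_one_units_smul (z : ZMod l) : (-1 : ℤˣ) • z = -z := by
  rw [Units.smul_def, Units.val_neg, Units.val_one, neg_smul, one_smul]

/-- For `2 < l`, `1 ≠ −1` in `𝔽_l`. [folklore] -/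
private theorem one_ne_neg_one (hl : 2 < l) : (1 : ZMod l) ≠ -1 := by
  intro h
  have h2 : ((2 : ℕ) : ZMod l) = 0 := by
    rw [Nat.cast_ofNat]
    calc (2 : ZMod l) = 1 + 1 := one_add_one_eq_two.symm
      _ = 1 + -1 := by nth_rw 2 [h]
      _ = 0 := add_neg_cancel 1
  rw [ZMod.natCast_eq_zero_iff] at h2
  exact absurd (Nat.le_of_dvd two_pos h2) (not_le.mpr hl)

/-- For `2 < l`, a sign is determined by its action on `1 ∈ 𝔽_l`. [folklore] -/
private theorem sign_eq_of_smul_one_eq (hl : 2 < l) {ε η : ℤˣ} (h : ε • (1 : ZMod l) = η • 1) :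
    ε = η := by
  rcases Int.units_eq_one_or ε with rfl | rfl <;> rcases Int.units_eq_one_or η with rfl | rfl
  · rfl
  · rw [one_smul, neg_one_units_smul] at h
    exact absurd h (one_ne_neg_one l hl)
  · rw [one_smul, neg_one_units_smul] at h
    exact absurd h.symm (one_ne_neg_one l hl)
  · rfl

/-! ### `𝔽_l^{⋊±} = 𝔽_l ⋊ {±1}` -/

/-- The action of `{±1} = ℤˣ` on `𝔽_l` by multiplication (through `ℤˣ → 𝔽_l^×`), as group
automorphisms of `Multiplicative 𝔽_l` — the datum defining the semidirect product `𝔽_l ⋊ {±1}`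
of [IUTchI] Def 6.1 (i). [cite: Mochizuki2012, IUTchI Def 6.1 (i) p.155] -/
def signAct : ℤˣ →* MulAut (Multiplicative (ZMod l)) where
  toFun ε := AddEquiv.toMultiplicative (DistribMulAction.toAddEquiv (ZMod l) ε)
  map_one' := by ext x; simp
  map_mul' ε ε' := by ext x; simp [smul_smul, mul_comm]

/-- The sign `ε` acts on `Multiplicative 𝔽_l` by `z ↦ ε • z`.
[cite: Mochizuki2012, IUTchI Def 6.1 (i) p.155] -/
@[simp] theorem signAct_apply (ε : ℤˣ) (x : Multiplicative (ZMod l)) :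
    signAct l ε x = Multiplicative.ofAdd (ε • x.toAdd) := rfl

/-- `𝔽_l^{⋊±} := 𝔽_l ⋊ {±1}`, "the group determined by forming the semi-direct product with respect
to the natural inclusion `{±1} ↪ 𝔽_l^×`" ([IUTchI] Def 6.1 (i), p. 155); an element is a pair
`⟨λ, ε⟩` with `λ ∈ 𝔽_l` (field `left`, written multiplicatively) and `ε ∈ {±1}` (field `right`).
[cite: Mochizuki2012, IUTchI Def 6.1 (i) p.155] -/
abbrev FlPM : Type := SemidirectProduct (Multiplicative (ZMod l)) ℤˣ (signAct l)

namespace FlPM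

variable {l}

/-- The element `(λ, ε)` of `𝔽_l^{⋊±}`, i.e. the affine map `z ↦ ε z + λ`.
[cite: Mochizuki2012, IUTchI Def 6.1 (i) p.155] -/
def mk (c : ZMod l) (ε : ℤˣ) : FlPM l := ⟨Multiplicative.ofAdd c, ε⟩

/-- The translation part of `(λ, ε)` is `λ`. [cite: Mochizuki2012, IUTchI Def 6.1 (i) p.155] -/
@[simp] theorem mk_left (c : ZMod l) (ε : ℤˣ) : (mk c ε).left = Multiplicative.ofAdd c := rfl

/-- The sign part of `(λ, ε)` is `ε`. [cite: Mochizuki2012, IUTchI Def 6.1 (i) p.155] -/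
@[simp] theorem mk_right (c : ZMod l) (ε : ℤˣ) : (mk c ε).right = ε := rfl

variable (l) in
/-- The natural surjection `𝔽_l^{⋊±} ↠ {±1}` ([IUTchI] Def 6.1 (i), p. 155).
[cite: Mochizuki2012, IUTchI Def 6.1 (i) p.155] -/
abbrev sign : FlPM l →* ℤˣ := SemidirectProduct.rightHom

/-- `𝔽_l^{⋊±} ↠ {±1}` is surjective. [cite: Mochizuki2012, IUTchI Def 6.1 (i) p.155] -/
theorem sign_surjective : Function.Surjective (sign l) := SemidirectProduct.rightHom_surjective

/-- An element of `𝔽_l^{⋊±}` is *positive* if it maps to `+1` under `𝔽_l^{⋊±} ↠ {±1}`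
([IUTchI] Def 6.1 (i), p. 155). [cite: Mochizuki2012, IUTchI Def 6.1 (i) p.155] -/
def IsPositive (g : FlPM l) : Prop := g.right = 1

/-- An element of `𝔽_l^{⋊±}` is *negative* if it maps to `−1` under `𝔽_l^{⋊±} ↠ {±1}`
([IUTchI] Def 6.1 (i), p. 155). [cite: Mochizuki2012, IUTchI Def 6.1 (i) p.155] -/
def IsNegative (g : FlPM l) : Prop := g.right = -1

/-- Every element of `𝔽_l^{⋊±}` is positive or negative.
[cite: Mochizuki2012, IUTchI Def 6.1 (i) p.155] -/
theorem isPositive_or_isNegative (g : FlPM l) : g.IsPositive ∨ g.IsNegative :=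
  Int.units_eq_one_or g.right

/-- No element of `𝔽_l^{⋊±}` is both positive and negative.
[cite: Mochizuki2012, IUTchI Def 6.1 (i) p.155] -/
theorem not_isPositive_and_isNegative (g : FlPM l) : ¬ (g.IsPositive ∧ g.IsNegative) := by
  rintro ⟨h₁, h₂⟩
  rw [IsPositive] at h₁
  rw [IsNegative, h₁] at h₂
  exact absurd h₂ (by decide)

variable (l) in
/-- The subgroup of positive elements of `𝔽_l^{⋊±}`, i.e. the kernel of `𝔽_l^{⋊±} ↠ {±1}`, which is
the copy `𝔽_l ⊆ 𝔽_l ⋊ {±1}` of the translations. [cite: Mochizuki2012, IUTchI Def 6.1 (i) p.155] -/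
def positives : Subgroup (FlPM l) := (sign l).ker

/-- An element is in the subgroup of positive elements iff it is positive.
[cite: Mochizuki2012, IUTchI Def 6.1 (i) p.155] -/
theorem mem_positives_iff (g : FlPM l) : g ∈ positives l ↔ g.IsPositive := MonoidHom.mem_ker

/-- The positive elements are exactly the image of `𝔽_l ↪ 𝔽_l ⋊ {±1}`.
[cite: Mochizuki2012, IUTchI Def 6.1 (i) p.155] -/
theorem positives_eq_range_inl : positives l = (SemidirectProduct.inl).range :=
  SemidirectProduct.range_inl_eq_ker_rightHom.symm

/-- The positive elements form a subgroup of index `2` in `𝔽_l^{⋊±}`.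
[cite: Mochizuki2012, IUTchI Def 6.1 (i) p.155] -/
theorem index_positives : (positives l).index = 2 := by
  rw [positives, Subgroup.index_ker, MonoidHom.range_eq_top.mpr sign_surjective,
    Subgroup.card_top, Nat.card_eq_fintype_card, Fintype.card_units_int]

/-- The action of `𝔽_l^{⋊±}` on `𝔽_l` "by automorphisms of the form `𝔽_l ∋ z ↦ ±z + λ ∈ 𝔽_l`, for
`λ ∈ 𝔽_l`" ([IUTchI] Def 6.1 (i), p. 155): `(λ, ε) • z = ε z + λ`.
[cite: Mochizuki2012, IUTchI Def 6.1 (i) p.155] -/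
instance : MulAction (FlPM l) (ZMod l) where
  smul g z := g.right • z + g.left.toAdd
  one_smul z := by
    change (1 : FlPM l).right • z + (1 : FlPM l).left.toAdd = z
    simp
  mul_smul g h z := by
    change (g * h).right • z + (g * h).left.toAdd =
      g.right • (h.right • z + h.left.toAdd) + g.left.toAdd
    rw [SemidirectProduct.mul_right, SemidirectProduct.mul_left, signAct_apply, mul_smul, smul_add,
      toAdd_mul, toAdd_ofAdd]
    abel

/-- `(λ, ε) • z = ε • z + λ`. [cite: Mochizuki2012, IUTchI Def 6.1 (i) p.155] -/
theorem smul_def (g : FlPM l) (z : ZMod l) : g • z = g.right • z + g.left.toAdd := rfl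

/-- `(λ, ε) • z = ε • z + λ` for the constructor `FlPM.mk`.
[cite: Mochizuki2012, IUTchI Def 6.1 (i) p.155] -/
@[simp] theorem mk_smul (c : ZMod l) (ε : ℤˣ) (z : ZMod l) : mk c ε • z = ε • z + c := rfl

/-- The translation `z ↦ z + λ` as a (positive) element of `𝔽_l^{⋊±}`.
[cite: Mochizuki2012, IUTchI Def 6.1 (i) p.155] -/
def transl (c : ZMod l) : FlPM l := mk c 1

/-- A translation acts by `z ↦ z + λ`. [cite: Mochizuki2012, IUTchI Def 6.1 (i) p.155] -/
@[simp] theorem transl_smul (c z : ZMod l) : transl c • z = z + c := by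
  simp [transl, add_comm]

/-- Translations have sign `+1`. [cite: Mochizuki2012, IUTchI Def 6.1 (i) p.155] -/
@[simp] theorem transl_right (c : ZMod l) : (transl c).right = 1 := rfl

/-- Translations are positive. [cite: Mochizuki2012, IUTchI Def 6.1 (i) p.155] -/
theorem transl_isPositive (c : ZMod l) : (transl c).IsPositive := rfl

/-- The positive elements of `𝔽_l^{⋊±}` are exactly the translations `z ↦ z + λ`.
[cite: Mochizuki2012, IUTchI Def 6.1 (i) p.155] -/
theorem isPositive_iff_exists_transl (g : FlPM l) : g.IsPositive ↔ ∃ c, g = transl c := by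
  constructor
  · intro h
    refine ⟨g.left.toAdd, ?_⟩
    ext
    · simp [transl, mk]
    · simpa [transl, mk, IsPositive] using h
  · rintro ⟨c, rfl⟩
    exact transl_isPositive c

variable (l) in
/-- `𝔽_l^{⋊±}` acting on `𝔽_l`, as a homomorphism to the permutation group of `𝔽_l`.
[cite: Mochizuki2012, IUTchI Def 6.1 (i) p.155] -/
def toPerm : FlPM l →* Equiv.Perm (ZMod l) := MulAction.toPermHom (FlPM l) (ZMod l)

/-- The permutation of `𝔽_l` attached to `g ∈ 𝔽_l^{⋊±}` is `z ↦ g • z`.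
[cite: Mochizuki2012, IUTchI Def 6.1 (i) p.155] -/
@[simp] theorem toPerm_apply (g : FlPM l) (z : ZMod l) : toPerm l g z = g • z := rfl

/-- For `2 < l` the action of `𝔽_l^{⋊±}` on `𝔽_l` is faithful: an affine map `z ↦ ε z + λ`
determines `(λ, ε)`. [cite: Mochizuki2012, IUTchI Def 6.1 (i) p.155] -/
theorem toPerm_injective (hl : 2 < l) : Function.Injective (toPerm l) := by
  intro g h hgh
  have h0 := congrArg (fun σ => σ (0 : ZMod l)) hgh
  have h1 := congrArg (fun σ => σ (1 : ZMod l)) hgh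
  simp only [toPerm_apply, smul_def, smul_zero, zero_add] at h0 h1
  rw [h0, add_left_inj] at h1
  ext
  · exact congrArg Multiplicative.ofAdd h0
  · exact congrArg Units.val (sign_eq_of_smul_one_eq l hl h1)

/-- Conjugating a translation by `g = (μ, ε) ∈ 𝔽_l^{⋊±}` gives the translation by `ε • c`.
[cite: Mochizuki2012, IUTchI Def 6.1 (i) p.155] -/
theorem smul_inv_smul_add (g : FlPM l) (c z : ZMod l) : g • (g⁻¹ • z + c) = z + g.right • c := by
  have h := smul_inv_smul g z
  rw [smul_def] at h ⊢
  rw [smul_add, add_right_comm, h]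

end FlPM

/-! ### `𝔽_l^±`-groups -/

/-- The permutation `z ↦ ε z` of `𝔽_l` given by a sign `ε ∈ {±1} = ℤˣ`.
[cite: Mochizuki2012, IUTchI Def 6.1 (i) p.155] -/
def signPerm (ε : ℤˣ) : Equiv.Perm (ZMod l) := MulAction.toPerm ε

/-- `signPerm ε` is `z ↦ ε • z`. [cite: Mochizuki2012, IUTchI Def 6.1 (i) p.155] -/
@[simp] theorem signPerm_apply (ε : ℤˣ) (z : ZMod l) : signPerm l ε z = ε • z := rfl

/-- An **`𝔽_l^±`-group** structure on a set `E`: "any set `E` equipped with a `{±1}`-orbit of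
bijections `E ≃ 𝔽_l`" ([IUTchI] Def 6.1 (i), p. 155). The orbit is the set `charts`; `eq_orbit`
says it is the `{±1}`-orbit (under post-composition with `z ↦ ±z`) of each of its members.
[cite: Mochizuki2012, IUTchI Def 6.1 (i) p.155] -/
structure FlPMGroup (E : Type*) where
  /-- the `{±1}`-orbit of bijections `E ≃ 𝔽_l` -/
  charts : Set (E ≃ ZMod l)
  /-- the orbit is nonempty -/
  nonempty : charts.Nonempty
  /-- `charts` is the `{±1}`-orbit of each of its members -/
  eq_orbit : ∀ e ∈ charts, charts = Set.range fun ε : ℤˣ => e.trans (signPerm l ε)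

namespace FlPMGroup

variable {l} {E : Type*} (S : FlPMGroup l E)

variable (l) in
/-- The tautological `𝔽_l^±`-group structure on `𝔽_l` itself (the orbit of the identity), used for
the index sets of the model bridges of [IUTchI] Example 6.2 (i) ("let us think of `𝔽_l` as an
`𝔽_l^±`-group [relative to the tautological `𝔽_l^±`-group structure]").
[cite: Mochizuki2012, IUTchI Ex 6.2 (i) p.159] -/
def tautological : FlPMGroup l (ZMod l) where
  charts := Set.range fun ε : ℤˣ => signPerm l ε
  nonempty := ⟨signPerm l 1, 1, rfl⟩
  eq_orbit := by
    rintro e ⟨ε, rfl⟩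
    ext σ
    constructor
    · rintro ⟨η, rfl⟩
      refine ⟨η * ε⁻¹, ?_⟩
      ext z
      simp only [Equiv.trans_apply, signPerm_apply, smul_smul, inv_mul_cancel_right]
    · rintro ⟨η, rfl⟩
      refine ⟨η * ε, ?_⟩
      ext z
      simp only [Equiv.trans_apply, signPerm_apply, smul_smul]

/-- Any two charts of an `𝔽_l^±`-group differ by a sign.
[cite: Mochizuki2012, IUTchI Def 6.1 (i) p.155] -/
theorem exists_sign_of_mem {e e' : E ≃ ZMod l} (he : e ∈ S.charts) (he' : e' ∈ S.charts) :
    ∃ ε : ℤˣ, e' = e.trans (signPerm l ε) := by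
  rw [S.eq_orbit e he] at he'
  obtain ⟨ε, rfl⟩ := he'
  exact ⟨ε, rfl⟩

/-- The orbit of charts of an `𝔽_l^±`-group is stable under signs.
[cite: Mochizuki2012, IUTchI Def 6.1 (i) p.155] -/
theorem trans_signPerm_mem {e : E ≃ ZMod l} (he : e ∈ S.charts) (ε : ℤˣ) :
    e.trans (signPerm l ε) ∈ S.charts := by
  rw [S.eq_orbit e he]
  exact ⟨ε, rfl⟩

/-- A chosen chart of the orbit (any two differ by a sign).
[cite: Mochizuki2012, IUTchI Def 6.1 (i) p.155] -/
noncomputable def chart₀ : E ≃ ZMod l := S.nonempty.some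

/-- The chosen chart belongs to the orbit. [cite: Mochizuki2012, IUTchI Def 6.1 (i) p.155] -/
theorem chart₀_mem : S.chart₀ ∈ S.charts := S.nonempty.some_mem

/-- "Thus, any `𝔽_l^±`-group `E` is equipped with a natural `𝔽_l`-module structure" ([IUTchI]
Def 6.1 (i), p. 155): the abelian group structure transported along a chart of the orbit (it does
not depend on the chart: `FlPMGroup.map_add`). [cite: Mochizuki2012, IUTchI Def 6.1 (i) p.155] -/
@[reducible] noncomputable def addCommGroup : AddCommGroup E := S.chart₀.addCommGroup

/-- The chosen chart is additive for the transported structure (by construction).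
[cite: Mochizuki2012, IUTchI Def 6.1 (i) p.155] -/
theorem chart₀_add (x y : E) : letI := S.addCommGroup; S.chart₀ (x + y) = S.chart₀ x + S.chart₀ y := by
  letI := S.addCommGroup
  exact S.chart₀.apply_symm_apply _

/-- The chosen chart sends `0` to `0` (by construction).
[cite: Mochizuki2012, IUTchI Def 6.1 (i) p.155] -/
theorem chart₀_zero : letI := S.addCommGroup; S.chart₀ (0 : E) = 0 := by
  letI := S.addCommGroup
  exact S.chart₀.apply_symm_apply _

/-- The chosen chart commutes with `ℕ`-scalar multiplication (by construction).
[cite: Mochizuki2012, IUTchI Def 6.1 (i) p.155] -/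
theorem chart₀_nsmul (n : ℕ) (x : E) : letI := S.addCommGroup; S.chart₀ (n • x) = n • S.chart₀ x := by
  letI := S.addCommGroup
  exact S.chart₀.apply_symm_apply _

/-- The natural abelian group structure of an `𝔽_l^±`-group is killed by `l`.
[cite: Mochizuki2012, IUTchI Def 6.1 (i) p.155] -/
theorem card_nsmul_eq_zero (x : E) : letI := S.addCommGroup; l • x = 0 := by
  letI := S.addCommGroup
  apply S.chart₀.injective
  rw [S.chart₀_nsmul, S.chart₀_zero, nsmul_eq_mul, ZMod.natCast_self, zero_mul]

/-- The natural `𝔽_l`-module structure of an `𝔽_l^±`-group ([IUTchI] Def 6.1 (i), p. 155): an abelian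
group killed by `l` is an `𝔽_l`-module. [cite: Mochizuki2012, IUTchI Def 6.1 (i) p.155] -/
@[reducible] noncomputable def module : letI := S.addCommGroup; Module (ZMod l) E :=
  letI := S.addCommGroup
  AddCommGroup.zmodModule S.card_nsmul_eq_zero

/-- Every chart of the `{±1}`-orbit is additive for the natural `𝔽_l`-module structure — i.e. the
structure is independent of the choice of chart, since `z ↦ −z` is additive ([IUTchI] Def 6.1 (i),
p. 155). [cite: Mochizuki2012, IUTchI Def 6.1 (i) p.155] -/
theorem map_add {e : E ≃ ZMod l} (he : e ∈ S.charts) (x y : E) :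
    letI := S.addCommGroup; e (x + y) = e x + e y := by
  letI := S.addCommGroup
  obtain ⟨ε, rfl⟩ := S.exists_sign_of_mem S.chart₀_mem he
  simp only [Equiv.trans_apply, signPerm_apply, S.chart₀_add, smul_add]

end FlPMGroup

end Literature.IUT.HodgeTheaters
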